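import Summits.QuantumFields.YangMills.Theorems.FibreAnchor.Negative.TubeVocabulary

/-!
# `FibreAnchor` — negative lemmas, part 2/3: the dangling-link indicator and its variance floor
# (crux stmt-QuantumFields-16243, route `ContractibleFibre`; cdisprove cycle 1)

At fibre width `M = 0` the indicator `obs O x₀ = 1{U (x₀, 2) ∈ O}` of ONE (dangling) direction-`2`
link has, under the free-tube Wilson measure at ANY coupling `β`, on ANY period `L`, at ANY
position, expectation pinned in `[1/k, 1/2]` (`Ex_obs_mem`) and variance `≥ 1/(2k)`
(`variance_floor`, `exists_variance_floor`), where `O ∋ 1` is open and disjoint from its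
`a`-translate (`a ≠ 1`, `exists_open_translate_disjoint`) and `k` left-translates of `O` cover
`G`. Proof: translation invariance of the un-normalised functional (`J_obs_translate`, from part
1's `integral_comp_mulDir`) + monotonicity/additivity of the integral (`two_J_le_Z`,
`Z_le_card_mul_J`). Also: slab locality and time shift of `obs` (`loc_obs`, `obs_shiftT`) and an
elementary decay-beats-constant lemma (`exists_forall_lt_of_pos`).
-/

set_option autoImplicit false

noncomputable section

open MeasureTheory
open Literature.MathematicalPhysics.QuantumFieldTheory
open Summit.QuantumFields.YangMills.Theses.ContractibleFibre
open Summit.QuantumFields.YangMills.Theorems.FibreAnchor.Negative.TubeVocabulary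

namespace Summit.QuantumFields.YangMills.Theorems.FibreAnchor.Negative.DanglingLink

/-! ## (D) The one-link observable of a dangling link -/

section ObsBasic

variable {G : Type}

/-- Value `1` on the event. -/
theorem obs_of_mem {O : Set G} {L : ℕ} {x₀ : St L 0} {U : Cfg G L 0} (h : U (x₀, 2) ∈ O) :
    obs O x₀ U = 1 := by
  simp [obs, h]

/-- Value `0` off the event. -/
theorem obs_of_not_mem {O : Set G} {L : ℕ} {x₀ : St L 0} {U : Cfg G L 0} (h : U (x₀, 2) ∉ O) :
    obs O x₀ U = 0 := by
  simp [obs, h]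

/-- `obs O x₀` depends on the link `(x₀, 2)` only. -/
theorem obs_congr (O : Set G) {L : ℕ} (x₀ : St L 0) {U U' : Cfg G L 0}
    (h : U (x₀, 2) = U' (x₀, 2)) : obs O x₀ U = obs O x₀ U' := by
  simp only [obs, h]

/-- `0 ≤ obs`. -/
theorem obs_nonneg (O : Set G) {L : ℕ} (x₀ : St L 0) (U : Cfg G L 0) : 0 ≤ obs O x₀ U := by
  by_cases h : U (x₀, 2) ∈ O
  · rw [obs_of_mem h]; norm_num
  · rw [obs_of_not_mem h]

/-- `obs ≤ 1`. -/
theorem obs_le_one (O : Set G) {L : ℕ} (x₀ : St L 0) (U : Cfg G L 0) : obs O x₀ U ≤ 1 := by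
  by_cases h : U (x₀, 2) ∈ O
  · rw [obs_of_mem h]
  · rw [obs_of_not_mem h]; norm_num

/-- `|obs| ≤ 1`. -/
theorem abs_obs_le (O : Set G) {L : ℕ} (x₀ : St L 0) (U : Cfg G L 0) : |obs O x₀ U| ≤ 1 := by
  rw [abs_le]
  exact ⟨by linarith [obs_nonneg O x₀ U], obs_le_one O x₀ U⟩

/-- Indicators are idempotent. -/
theorem obs_mul_self (O : Set G) {L : ℕ} (x₀ : St L 0) (U : Cfg G L 0) :
    obs O x₀ U * obs O x₀ U = obs O x₀ U := by
  by_cases h : U (x₀, 2) ∈ O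
  · rw [obs_of_mem h]; norm_num
  · rw [obs_of_not_mem h]; norm_num

/-- `obs O x₀` is measurable for measurable `O`. -/
theorem measurable_obs [MeasurableSpace G] {O : Set G} (hO : MeasurableSet O) {L : ℕ}
    (x₀ : St L 0) : Measurable (obs O x₀ : Cfg G L 0 → ℝ) :=
  (measurable_const.indicator hO).comp (measurable_pi_apply (x₀, (2 : Fin 4)))

/-- The dangling-link symmetry translates the one-link observable. -/
theorem obs_mulDir [Group G] (O : Set G) (g : G) {L : ℕ} (x₀ : St L 0) (U : Cfg G L 0) :
    obs O x₀ (mulDir g L 0 U) = obs ((g * ·) ⁻¹' O) x₀ U := by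
  by_cases h : g * U (x₀, 2) ∈ O
  · rw [obs_of_mem (Set.mem_preimage.mpr h), obs_of_mem]
    rwa [mulDir_apply_two]
  · rw [obs_of_not_mem (fun h' => h (Set.mem_preimage.mp h')), obs_of_not_mem]
    rwa [mulDir_apply_two]

/-- The time shift by `n` moves the one-link indicator from time `c` to time `c + n`. -/
theorem obs_shiftT (O : Set G) {L : ℕ} (c : ZMod L) (n : ℕ) (U : Cfg G L 0) :
    obs O ((c, 0, 0, 0) : St L 0) (shiftT G L 0 n U) = obs O ((c + n, 0, 0, 0) : St L 0) U :=
  rfl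

end ObsBasic

section OneLink

variable {G : Type} [Group G] [TopologicalSpace G] [IsTopologicalGroup G] [CompactSpace G]
  [MeasurableSpace G] [BorelSpace G]

/-- **(D) The law of a dangling link is translation invariant** (un-normalised form). -/
theorem J_obs_translate (r : LatticeRep G) (β : ℝ) {O : Set G} (hO : MeasurableSet O) (g : G)
    {L : ℕ} [NeZero L] (x₀ : St L 0) :
    ∫ U, obs ((g * ·) ⁻¹' O) x₀ U * wgt G r L 0 β U ∂(haarPi G L 0) =
      ∫ U, obs O x₀ U * wgt G r L 0 β U ∂(haarPi G L 0) := by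
  have h := integral_comp_mulDir r g L β (measurable_obs hO x₀)
  simpa only [obs_mulDir] using h

/-- **Upper bound**: if `O` is disjoint from its translate `a⁻¹ O`, the dangling link is in `O`
with probability at most `1/2`. -/
theorem two_J_le_Z (r : LatticeRep G) (β : ℝ) {O : Set G} (hO : MeasurableSet O) {a : G}
    (haO : ∀ x ∈ O, a * x ∉ O) {L : ℕ} [NeZero L] (x₀ : St L 0) :
    2 * ∫ U, obs O x₀ U * wgt G r L 0 β U ∂(haarPi G L 0) ≤
      ∫ U, wgt G r L 0 β U ∂(haarPi G L 0) := by
  have hOa : MeasurableSet ((a * ·) ⁻¹' O) := measurable_const_mul a hO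
  have hpt : ∀ U : Cfg G L 0, obs O x₀ U + obs ((a * ·) ⁻¹' O) x₀ U ≤ 1 := by
    intro U
    by_cases h1 : U (x₀, 2) ∈ O
    · rw [obs_of_mem h1, obs_of_not_mem (fun h => haO _ h1 (Set.mem_preimage.mp h))]
      norm_num
    · rw [obs_of_not_mem h1, zero_add]
      exact obs_le_one _ x₀ U
  have hi₁ := integrable_mul_wgt r L 0 β (measurable_obs hO x₀) (abs_obs_le O x₀)
  have hi₂ := integrable_mul_wgt r L 0 β (measurable_obs hOa x₀) (abs_obs_le _ x₀)
  calc 2 * ∫ U, obs O x₀ U * wgt G r L 0 β U ∂(haarPi G L 0)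
      = (∫ U, obs O x₀ U * wgt G r L 0 β U ∂(haarPi G L 0)) +
          ∫ U, obs ((a * ·) ⁻¹' O) x₀ U * wgt G r L 0 β U ∂(haarPi G L 0) := by
        rw [two_mul, J_obs_translate r β hO a x₀]
    _ = ∫ U, (obs O x₀ U * wgt G r L 0 β U + obs ((a * ·) ⁻¹' O) x₀ U * wgt G r L 0 β U)
          ∂(haarPi G L 0) := (integral_add hi₁ hi₂).symm
    _ ≤ ∫ U, wgt G r L 0 β U ∂(haarPi G L 0) := by
        refine integral_mono (hi₁.add hi₂) (integrable_wgt r L 0 β) fun U => ?_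
        have hw := (wgt_pos r L 0 β U).le
        calc obs O x₀ U * wgt G r L 0 β U + obs ((a * ·) ⁻¹' O) x₀ U * wgt G r L 0 β U
            = (obs O x₀ U + obs ((a * ·) ⁻¹' O) x₀ U) * wgt G r L 0 β U := (add_mul _ _ _).symm
          _ ≤ 1 * wgt G r L 0 β U := mul_le_mul_of_nonneg_right (hpt U) hw
          _ = wgt G r L 0 β U := one_mul _

/-- **Lower bound**: if finitely many translates of `O` cover `G`, the dangling link is in `O`
with probability at least `1 / #translates`. -/
theorem Z_le_card_mul_J (r : LatticeRep G) (β : ℝ) {O : Set G} (hO : MeasurableSet O)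
    (t : Finset G) (ht : ∀ x : G, ∃ g ∈ t, g * x ∈ O) {L : ℕ} [NeZero L] (x₀ : St L 0) :
    ∫ U, wgt G r L 0 β U ∂(haarPi G L 0) ≤
      t.card * ∫ U, obs O x₀ U * wgt G r L 0 β U ∂(haarPi G L 0) := by
  have hOg : ∀ g : G, MeasurableSet ((g * ·) ⁻¹' O) := fun g => measurable_const_mul g hO
  have hpt : ∀ U : Cfg G L 0, (1 : ℝ) ≤ ∑ g ∈ t, obs ((g * ·) ⁻¹' O) x₀ U := by
    intro U
    obtain ⟨g, hg, hgx⟩ := ht (U (x₀, 2))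
    have h1 : obs ((g * ·) ⁻¹' O) x₀ U = 1 := obs_of_mem (Set.mem_preimage.mpr hgx)
    calc (1 : ℝ) = obs ((g * ·) ⁻¹' O) x₀ U := h1.symm
      _ ≤ ∑ g' ∈ t, obs ((g' * ·) ⁻¹' O) x₀ U :=
          Finset.single_le_sum (f := fun g' => obs ((g' * ·) ⁻¹' O) x₀ U)
            (fun g' _ => obs_nonneg _ x₀ U) hg
  have hi : ∀ g ∈ t, Integrable (fun U => obs ((g * ·) ⁻¹' O) x₀ U * wgt G r L 0 β U)
      (haarPi G L 0) := fun g _ => integrable_mul_wgt r L 0 β (measurable_obs (hOg g) x₀)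
        (abs_obs_le _ x₀)
  calc ∫ U, wgt G r L 0 β U ∂(haarPi G L 0)
      ≤ ∫ U, ∑ g ∈ t, obs ((g * ·) ⁻¹' O) x₀ U * wgt G r L 0 β U ∂(haarPi G L 0) := by
        refine integral_mono (integrable_wgt r L 0 β) (integrable_finsetSum t hi) fun U => ?_
        have hw := (wgt_pos r L 0 β U).le
        calc wgt G r L 0 β U = 1 * wgt G r L 0 β U := (one_mul _).symm
          _ ≤ (∑ g ∈ t, obs ((g * ·) ⁻¹' O) x₀ U) * wgt G r L 0 β U :=
              mul_le_mul_of_nonneg_right (hpt U) hw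
          _ = ∑ g ∈ t, obs ((g * ·) ⁻¹' O) x₀ U * wgt G r L 0 β U := Finset.sum_mul _ _ _
    _ = ∑ g ∈ t, ∫ U, obs ((g * ·) ⁻¹' O) x₀ U * wgt G r L 0 β U ∂(haarPi G L 0) :=
        integral_finsetSum t hi
    _ = ∑ g ∈ t, ∫ U, obs O x₀ U * wgt G r L 0 β U ∂(haarPi G L 0) :=
        Finset.sum_congr rfl fun g _ => J_obs_translate r β hO g x₀
    _ = t.card * ∫ U, obs O x₀ U * wgt G r L 0 β U ∂(haarPi G L 0) := by
        rw [Finset.sum_const, nsmul_eq_mul]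

/-- **(D) The expectation of the dangling-link indicator is pinned in `[1/k, 1/2]`**, uniformly
in `L`, `β` and the position of the link. -/
theorem Ex_obs_mem (r : LatticeRep G) (β : ℝ) {O : Set G} (hO : MeasurableSet O) {a : G}
    (haO : ∀ x ∈ O, a * x ∉ O) (t : Finset G) (ht : ∀ x : G, ∃ g ∈ t, g * x ∈ O)
    {L : ℕ} [NeZero L] (x₀ : St L 0) :
    1 / (t.card : ℝ) ≤ Ex G r L 0 β (obs O x₀) ∧ Ex G r L 0 β (obs O x₀) ≤ 1 / 2 := by
  have hZ := Z_pos r L 0 β (G := G)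
  have hup := two_J_le_Z r β hO haO x₀
  have hlo := Z_le_card_mul_J r β hO t ht x₀
  have hk : (0 : ℝ) < t.card := by
    have : t.Nonempty := by
      obtain ⟨g, hg, -⟩ := ht 1
      exact ⟨g, hg⟩
    exact_mod_cast this.card_pos
  rw [Ex_eq]
  constructor
  · rw [div_le_div_iff₀ hk hZ, one_mul, mul_comm]
    exact hlo
  · rw [div_le_div_iff₀ hZ two_pos, one_mul, mul_comm]
    exact hup

/-- **The variance floor.** `Ex(obs) − Ex(obs)² ≥ 1/(2k)`. -/
theorem variance_floor (r : LatticeRep G) (β : ℝ) {O : Set G} (hO : MeasurableSet O) {a : G}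
    (haO : ∀ x ∈ O, a * x ∉ O) (t : Finset G) (ht : ∀ x : G, ∃ g ∈ t, g * x ∈ O)
    {L : ℕ} [NeZero L] (x₀ : St L 0) :
    1 / (2 * (t.card : ℝ)) ≤
      Ex G r L 0 β (obs O x₀) - Ex G r L 0 β (obs O x₀) * Ex G r L 0 β (obs O x₀) := by
  obtain ⟨hPlo, hPhi⟩ := Ex_obs_mem r β hO haO t ht x₀
  set P := Ex G r L 0 β (obs O x₀)
  have h1 : 1 / (t.card : ℝ) * (1 / 2) ≤ P * (1 - P) :=
    mul_le_mul hPlo (by linarith) (by norm_num) (le_trans (by positivity) hPlo)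
  calc 1 / (2 * (t.card : ℝ)) = 1 / (t.card : ℝ) * (1 / 2) := by ring
    _ ≤ P * (1 - P) := h1
    _ = P - P * P := by ring

omit [IsTopologicalGroup G] [CompactSpace G] [MeasurableSpace G] [BorelSpace G] in
/-- In a Hausdorff topological group with an element `a ≠ 1` there is an open neighbourhood of
`1` disjoint from its `a`-translate. -/
theorem exists_open_translate_disjoint [T2Space G] [ContinuousMul G] {a : G} (ha : a ≠ 1) :
    ∃ O : Set G, IsOpen O ∧ (1 : G) ∈ O ∧ ∀ x ∈ O, a * x ∉ O := by
  obtain ⟨V, V', hV, hV', h1, ha', hdisj⟩ := t2_separation (Ne.symm ha)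
  refine ⟨V ∩ (a * ·) ⁻¹' V', hV.inter (hV'.preimage (continuous_const_mul a)), ⟨h1, ?_⟩, ?_⟩
  · simpa using ha'
  · rintro x ⟨-, hx⟩ ⟨hax, -⟩
    exact Set.disjoint_left.mp hdisj hax hx

/-- **(D) packaged**: for a group with a faithful representation and an element `a ≠ 1` there are
an open `O` and a number `k ≥ 1` such that on EVERY `M = 0` tube, at every `β` and position, the
dangling-link indicator `obs O x₀` has `Ex(obs) − Ex(obs)² ≥ 1/(2k)`. -/
theorem exists_variance_floor (r : LatticeRep G) {a : G} (ha : a ≠ 1) :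
    ∃ O : Set G, IsOpen O ∧ ∃ k : ℝ, 0 < k ∧ ∀ (β : ℝ) (L : ℕ) [NeZero L] (x₀ : St L 0),
      1 / (2 * k) ≤
        Ex G r L 0 β (obs O x₀) - Ex G r L 0 β (obs O x₀) * Ex G r L 0 β (obs O x₀) := by
  haveI := (r.continuous.isClosedEmbedding r.injective).isEmbedding.t2Space
  obtain ⟨O, hO, h1O, haO⟩ := exists_open_translate_disjoint ha
  obtain ⟨t, ht⟩ := compact_covered_by_mul_left_translates (G := G) (V := O) isCompact_univ
    (by rw [hO.interior_eq]; exact ⟨1, h1O⟩)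
  have ht' : ∀ x : G, ∃ g ∈ t, g * x ∈ O := fun x => by
    simpa only [Set.mem_iUnion, Set.mem_preimage, exists_prop] using ht (Set.mem_univ x)
  have hk : (0 : ℝ) < t.card := by
    have : t.Nonempty := by
      obtain ⟨g, hg, -⟩ := ht' 1
      exact ⟨g, hg⟩
    exact_mod_cast this.card_pos
  exact ⟨O, hO, t.card, hk, fun β L _ x₀ => variance_floor r β hO.measurableSet haO t ht' x₀⟩

omit [IsTopologicalGroup G] [CompactSpace G] [MeasurableSpace G] [BorelSpace G] in
/-- Exponential decay beats any constant. -/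
theorem exists_forall_lt_of_pos (C m₀ v : ℝ) (hm₀ : 0 < m₀) (hv : 0 < v) :
    ∃ n₀ : ℕ, ∀ n : ℕ, n₀ ≤ n → C * Real.exp (-(m₀ * n)) < v := by
  have h : Filter.Tendsto (fun n : ℕ => C * Real.exp (-(m₀ * n))) Filter.atTop
      (nhds (C * 0)) := by
    refine tendsto_const_nhds.mul (Real.tendsto_exp_atBot.comp ?_)
    exact Filter.tendsto_neg_atTop_atBot.comp
      (tendsto_natCast_atTop_atTop.const_mul_atTop hm₀)
  rw [mul_zero] at h
  exact (h.eventually (eventually_lt_nhds hv)).exists_forall_of_atTop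

omit [Group G] [TopologicalSpace G] [IsTopologicalGroup G] [CompactSpace G] [BorelSpace G] in
/-- Slab locality of a one-link indicator: the link at time `c + j`, `j ≤ w`. -/
theorem loc_obs {O : Set G} (hO : MeasurableSet O) {L : ℕ} [NeZero L] (w : ℕ) (c : ZMod L)
    (j : ℕ) (hj : j ≤ w) :
    Measurable (obs O ((c + j, 0, 0, 0) : St L 0)) ∧
      (∀ U, |obs O ((c + j, 0, 0, 0) : St L 0) U| ≤ 1) ∧
      ∀ U U' : Cfg G L 0, (∀ p : St L 0 × Fin 4, (p.1.1 - c).val ≤ w → U p = U' p) →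
        obs O ((c + j, 0, 0, 0) : St L 0) U = obs O ((c + j, 0, 0, 0) : St L 0) U' := by
  refine ⟨measurable_obs hO _, abs_obs_le O _, fun U U' hUU' => obs_congr O _ (hUU' _ ?_)⟩
  show ((c + (j : ZMod L)) - c).val ≤ w
  rw [add_sub_cancel_left, ZMod.val_natCast]
  exact le_trans (Nat.mod_le j L) hj

end OneLink

end Summit.QuantumFields.YangMills.Theorems.FibreAnchor.Negative.DanglingLink

end
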